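import Summits.AnomalousDissipation.AnomalousDissipation.Theorems.TwohalfdNeg.Negative.LaminarShear

/-!
# Negative knowledge for the crux `TwohalfdNeg` (stmt-AnomalousDissipation-0211), II: three load-bearing
# hypotheses

Certified copy of §4 of the cdisprove work file `Cruxes/TwohalfdNeg/Disproof.lean`.  With the laminar
vertical-shear Leray–Hopf family of `Negative/LaminarShear.lean` as explicit witnesses: the crux with the energy
ceiling deleted is FALSE (`twohalfdNeg_false_without_energyBound`: fixed `f = (0,0,cos 2πx₀)`, `u_j = f/(4π²ν_j)`,
dissipation `(j+1)/(8π²)`), with `ν_j → 0` deleted is FALSE (`twohalfdNeg_false_without_vanishingViscosity`), and —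
the main point — with the force allowed to depend on the level it is FALSE EVEN FOR STEADY FORCES UNIFORMLY BOUNDED
IN `L^∞` (`twohalfdNeg_false_without_fixedForce`: `f_j = 4π² cos(2π(j+1)x₀) e₃`, `ν_j = (j+1)⁻²`,
`u_j = cos(2π(j+1)x₀) e₃`, energy `1/2`, dissipation `2π²` at every level — forcing at the dissipative scale
`|k| ~ ν^{-1/2}`): the steady, in-class, elementary shadow of
`Literature.Barriers.AnomalousDissipation.Cheskidov2023_thm13_not_forceRobustNoAnomaly`.  Any proof of the crux must
use that `f` is ONE FIXED field (`L²`-precompactness of the force family; the witnesses converge in `H⁻¹`, so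
negative-norm compactness is not enough), not merely norm bounds on it.
Supports stmt-AnomalousDissipation-0211.
-/

noncomputable section

namespace Summit.AnomalousDissipation.AnomalousDissipation.Theorems.TwohalfdNeg.Negative

open MeasureTheory Set Filter Topology UnitAddTorus
open scoped ENNReal NNReal InnerProductSpace
open Literature.Analysis.FunctionSpaces Literature.Analysis.FunctionSpaces.Torus
open Literature.Analysis.FluidPDE Literature.Analysis.FluidPDE.Torus

/-! ## 4. Load-bearing hypotheses: the crux with one hypothesis deleted is FALSE -/

section LoadBearing

/-- `TwohalfdNeg` with the ENERGY CEILING `∃ E, ∀ j, meanEnergy (u j) ≤ E` deleted (everything else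
verbatim). -/
def TwohalfdNegWithoutEnergyBound : Prop :=
  ∀ f : (UnitAddTorus (Fin 3)) → (EuclideanSpace ℝ (Fin 3)), (∀ (s : UnitAddCircle) (x : (UnitAddTorus (Fin 3))), f (x + Pi.single (2 : Fin 3) s) = f x) →
    IsSmooth f → IsDivFree f → HasZeroMean f →
    ∀ (ν : ℕ → ℝ) (u₀ : ℕ → (UnitAddTorus (Fin 3)) → (EuclideanSpace ℝ (Fin 3))) (u : ℕ → ℝ → (UnitAddTorus (Fin 3)) → (EuclideanSpace ℝ (Fin 3))),
      (∀ j, 0 < ν j) → Tendsto ν atTop (𝓝 0) →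
      (∀ j, IsGlobalLerayHopf (ν j) (fun _ => f) (u₀ j) (u j)) →
      (∀ j (t : ℝ) (s : UnitAddCircle) (x : (UnitAddTorus (Fin 3))), u j t (x + Pi.single (2 : Fin 3) s) = u j t x) →
      Tendsto (fun j => meanDissipation (ν j) (u j)) atTop (𝓝 0)

/-- **The energy ceiling is load-bearing.** Witness: the fixed vertical shear force
`f = (0,0,cos 2πx₀)`, `ν_j = 1/(j+1)`, and the laminar steady states `u_j = f/(4π²ν_j)` (global
Leray–Hopf, `x₃`-invariant), whose mean dissipation `(j+1)/(8π²)` does not tend to `0` (their mean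
energy `(j+1)²/(32π⁴)` is unbounded, as it must be). Any proof of the crux must use the energy bound
quantitatively against the laminar branch. [folklore] -/
theorem twohalfdNeg_false_without_energyBound : ¬ TwohalfdNegWithoutEnergyBound := by
  intro h
  have hν : ∀ j : ℕ, (0 : ℝ) < 1 / ((j : ℝ) + 1) := fun j => by positivity
  have hb : ∀ j : ℕ, (1 : ℝ) =
      4 * Real.pi ^ 2 * (((0 : ℕ) : ℝ) + 1) ^ 2 * (1 / ((j : ℝ) + 1)) * (((j : ℝ) + 1) / (4 * Real.pi ^ 2)) := by
    intro j
    have hj : (j : ℝ) + 1 ≠ 0 := by positivity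
    have hπ : (Real.pi : ℝ) ^ 2 ≠ 0 := by positivity
    field_simp
    simp
  have ht := h (shear 0 1) (shear_add_single 0 1) (isSmooth_shear 0 1) (isDivFree_shear 0 1)
    (hasZeroMean_shear 0 1) (fun j => 1 / ((j : ℝ) + 1))
    (fun j => shear 0 (((j : ℝ) + 1) / (4 * Real.pi ^ 2)))
    (fun j _ => shear 0 (((j : ℝ) + 1) / (4 * Real.pi ^ 2))) hν
    tendsto_one_div_add_atTop_nhds_zero_nat (fun j => isGlobalLerayHopf_shear 0 (hb j))
    (fun j _ s x => shear_add_single 0 _ s x)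
  refine not_tendsto_zero_of_le (c := 1 / (8 * Real.pi ^ 2)) (by positivity) (fun j => ?_) ht
  rw [meanDissipation_shear]
  have hj : (0 : ℝ) < (j : ℝ) + 1 := by positivity
  have hπ : (0 : ℝ) < Real.pi ^ 2 := by positivity
  have heq : 1 / ((j : ℝ) + 1) * (2 * Real.pi ^ 2 * (((0 : ℕ) : ℝ) + 1) ^ 2 *
      (((j : ℝ) + 1) / (4 * Real.pi ^ 2)) ^ 2) = ((j : ℝ) + 1) / (8 * Real.pi ^ 2) := by
    field_simp
    simp
    ring
  rw [heq]
  exact div_le_div_of_nonneg_right (by linarith) (by positivity)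

/-- `TwohalfdNeg` with `ν_j → 0` deleted (everything else verbatim). -/
def TwohalfdNegWithoutVanishingViscosity : Prop :=
  ∀ f : (UnitAddTorus (Fin 3)) → (EuclideanSpace ℝ (Fin 3)), (∀ (s : UnitAddCircle) (x : (UnitAddTorus (Fin 3))), f (x + Pi.single (2 : Fin 3) s) = f x) →
    IsSmooth f → IsDivFree f → HasZeroMean f →
    ∀ (ν : ℕ → ℝ) (u₀ : ℕ → (UnitAddTorus (Fin 3)) → (EuclideanSpace ℝ (Fin 3))) (u : ℕ → ℝ → (UnitAddTorus (Fin 3)) → (EuclideanSpace ℝ (Fin 3))),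
      (∀ j, 0 < ν j) →
      (∀ j, IsGlobalLerayHopf (ν j) (fun _ => f) (u₀ j) (u j)) →
      (∀ j (t : ℝ) (s : UnitAddCircle) (x : (UnitAddTorus (Fin 3))), u j t (x + Pi.single (2 : Fin 3) s) = u j t x) →
      (∃ E : ℝ, ∀ j, meanEnergy (u j) ≤ E) →
      Tendsto (fun j => meanDissipation (ν j) (u j)) atTop (𝓝 0)

/-- **Vanishing viscosity is load-bearing** (sanity check: the conclusion is about the limit
`ν → 0`, not about each solution). Witness: `ν_j = 1`, `f = (0,0,cos 2πx₀)`, the laminar state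
`u = f/(4π²)` at every level: bounded energy `1/(32π⁴)`, constant dissipation `1/(8π²)`. [folklore] -/
theorem twohalfdNeg_false_without_vanishingViscosity : ¬ TwohalfdNegWithoutVanishingViscosity := by
  intro h
  have hb : (1 : ℝ) = 4 * Real.pi ^ 2 * (((0 : ℕ) : ℝ) + 1) ^ 2 * 1 * (1 / (4 * Real.pi ^ 2)) := by
    have hπ : (Real.pi : ℝ) ^ 2 ≠ 0 := by positivity
    field_simp
    simp
  have ht := h (shear 0 1) (shear_add_single 0 1) (isSmooth_shear 0 1) (isDivFree_shear 0 1)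
    (hasZeroMean_shear 0 1) (fun _ => 1) (fun _ => shear 0 (1 / (4 * Real.pi ^ 2)))
    (fun _ _ => shear 0 (1 / (4 * Real.pi ^ 2))) (fun _ => one_pos)
    (fun _ => isGlobalLerayHopf_shear 0 hb) (fun _ _ s x => shear_add_single 0 _ s x)
    ⟨(1 / (4 * Real.pi ^ 2)) ^ 2 / 2, fun _ => (meanEnergy_shear 0 _).le⟩
  refine not_tendsto_zero_of_le (c := 1 * (2 * Real.pi ^ 2 * (((0 : ℕ) : ℝ) + 1) ^ 2 *
    (1 / (4 * Real.pi ^ 2)) ^ 2)) (by positivity) (fun j => (meanDissipation_shear 0 1 _).ge) ht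

/-- `TwohalfdNeg` with the force allowed to depend on the level `j` — each `f_j` steady, smooth,
divergence free, mean zero and `x₃`-invariant, and the family even UNIFORMLY BOUNDED IN `L^∞`
(`∃ M, ∀ j x, ‖f j x‖ ≤ M`) — everything else verbatim. -/
def TwohalfdNegWithoutFixedForce : Prop :=
  ∀ f : ℕ → (UnitAddTorus (Fin 3)) → (EuclideanSpace ℝ (Fin 3)), (∀ j (s : UnitAddCircle) (x : (UnitAddTorus (Fin 3))), f j (x + Pi.single (2 : Fin 3) s) = f j x) →
    (∀ j, IsSmooth (f j)) → (∀ j, IsDivFree (f j)) → (∀ j, HasZeroMean (f j)) →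
    (∃ M : ℝ, ∀ j x, ‖f j x‖ ≤ M) →
    ∀ (ν : ℕ → ℝ) (u₀ : ℕ → (UnitAddTorus (Fin 3)) → (EuclideanSpace ℝ (Fin 3))) (u : ℕ → ℝ → (UnitAddTorus (Fin 3)) → (EuclideanSpace ℝ (Fin 3))),
      (∀ j, 0 < ν j) → Tendsto ν atTop (𝓝 0) →
      (∀ j, IsGlobalLerayHopf (ν j) (fun _ => f j) (u₀ j) (u j)) →
      (∀ j (t : ℝ) (s : UnitAddCircle) (x : (UnitAddTorus (Fin 3))), u j t (x + Pi.single (2 : Fin 3) s) = u j t x) →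
      (∃ E : ℝ, ∀ j, meanEnergy (u j) ≤ E) →
      Tendsto (fun j => meanDissipation (ν j) (u j)) atTop (𝓝 0)

/-- **`ν`-INDEPENDENCE OF THE FORCE IS LOAD-BEARING** — the formal, elementary shadow of the barrier
`Literature.Barriers.AnomalousDissipation.Cheskidov2023_thm13_not_forceRobustNoAnomaly` inside this very
class, with STEADY forces: `f_j = 4π² cos(2π(j+1)x₀) e₃` (‖f_j‖_∞ = 4π², ‖f_j‖_{L²} = 8π⁴ fixed,
`f_j ⇀ 0`), `ν_j = (j+1)⁻²`, laminar states `u_j = cos(2π(j+1)x₀) e₃`: mean energy `1/2`, mean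
dissipation `2π²` at every level. Mechanism: forcing AT the dissipative scale `|k| ~ ν^{-1/2}` injects
energy straight into heat with no cascade. HENCE any proof of the crux must use that `f` is one fixed
field (at least: precompact in `L²` — no `L²`-mass escaping to frequencies `|k| → ∞`; NB the witness
family does converge in `H⁻¹`, so negative-norm compactness is NOT enough); `L^∞` or
`L²` bounds on the force, exact steadiness, smoothness of each `f_j`, `x₃`-invariance and the energy
ceiling together do NOT suffice. [folklore] -/
theorem twohalfdNeg_false_without_fixedForce : ¬ TwohalfdNegWithoutFixedForce := by
  intro h
  have hν : ∀ j : ℕ, (0 : ℝ) < (1 / ((j : ℝ) + 1)) ^ 2 := fun j => by positivity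
  have hν0 : Tendsto (fun j : ℕ => (1 / ((j : ℝ) + 1)) ^ 2) atTop (𝓝 0) := by
    simpa using (tendsto_one_div_add_atTop_nhds_zero_nat (𝕜 := ℝ)).pow 2
  have hb : ∀ j : ℕ, (4 * Real.pi ^ 2 : ℝ) =
      4 * Real.pi ^ 2 * ((j : ℝ) + 1) ^ 2 * (1 / ((j : ℝ) + 1)) ^ 2 * 1 := by
    intro j
    have hj : (j : ℝ) + 1 ≠ 0 := by positivity
    field_simp
  have ht := h (fun j => shear j (4 * Real.pi ^ 2)) (fun j s x => shear_add_single j _ s x)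
    (fun j => isSmooth_shear j _) (fun j => isDivFree_shear j _) (fun j => hasZeroMean_shear j _)
    ⟨|4 * Real.pi ^ 2|, fun j x => norm_shear_le j _ x⟩ (fun j => (1 / ((j : ℝ) + 1)) ^ 2)
    (fun j => shear j 1) (fun j _ => shear j 1) hν hν0 (fun j => isGlobalLerayHopf_shear j (hb j))
    (fun j _ s x => shear_add_single j 1 s x) ⟨1 ^ 2 / 2, fun j => (meanEnergy_shear j 1).le⟩
  refine not_tendsto_zero_of_le (c := 2 * Real.pi ^ 2) (by positivity) (fun j => ?_) ht
  rw [meanDissipation_shear]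
  have hj : (j : ℝ) + 1 ≠ 0 := by positivity
  have heq : (1 / ((j : ℝ) + 1)) ^ 2 * (2 * Real.pi ^ 2 * ((j : ℝ) + 1) ^ 2 * 1 ^ 2) = 2 * Real.pi ^ 2 := by
    field_simp
  rw [heq]

end LoadBearing

end Summit.AnomalousDissipation.AnomalousDissipation.Theorems.TwohalfdNeg.Negative

end
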